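import Summits.CriticalPhenomena.PercolationContinuityZ3.Theorems.PercNearOneGluingNoHeavyLowerTailSuperTerminalQuarticChord
import Summits.CriticalPhenomena.PercolationContinuityZ3.Theorems.PercNearOneGluingNoHeavyLowerTailSuperTerminalQuarticFace
import Summits.CriticalPhenomena.PercolationContinuityZ3.Theorems.PercNearOneGluingNoHeavyLowerTailThreePointIsoSexticEdgeNC
import Literature.Probability.Percolation.ShorteningInfluenceBound
import Literature.Probability.Percolation.GhostFieldMagnetization
import HarnessLib

/-!
# The F-monotone one-pair segment lemma for the super-terminal quartic law `V4`

Support file for crux `stmt-CriticalPhenomena-4575` (`NoHeavyLowerTail`), seat `prim-facecert` gen 22 (`--supports stmt-CriticalPhenomena-4575`);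
memo `run/shared/lean/prim/prim-l12/prim-facecert/FINDING-gen22-PENDANT-PORT-TREE-CLASS.md` §5/§7.  No definitions, no sorries, standard axioms.

`V4 : μ(F ∩ c∤T)⁴ ≤ μ(F ∩ c∤{s,a})²·μ(F ∩ (c↔b)ᶜ)²·μ(c∤T)`, `F = (s↔a)∩(s↔b)ᶜ`, `T = {s,a,b}` (lane notation).  Along the pencil of ANY pair `f` every
coordinate is affine in `w f` (`Literature…prodBernoulli_real_oneBond`), the port-isolation probability `μ(c∤T)` decreases (`real_cIso_update_one_le`),
and the two-state mixture lemma `SuperTerminalQuarticChord.quartic_of_twoStates` (convexity of the `V4` region in normal form, with the `F`-tilted weight)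
gives: **if `μ(F)` does not decrease from `w[f↦0]` to `w[f↦1]`, then `V4(w[f↦0]) ∧ V4(w[f↦1]) ⟹ V4(w)`** (`superTerminalQuartic_of_pair`).
Examples of F-nondecreasing pairs: the `s–a` pair; every pair separated from `b` by `{s,a}`; every pair separated from `{s,a}` by `b` (memo §5).
The hypothesis cannot be dropped as a METHOD: there are weighted graphs in which every pair is F-decreasing (memo §5, F-DIR′).
-/

namespace Summit.CriticalPhenomena.PercolationContinuityZ3.Theorems.SuperTerminalQuarticSegment

open MeasureTheory Set
open Literature.Probability.Percolation Literature.Probability.LatticeModels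
open Summit.CriticalPhenomena.PercolationContinuityZ3.Theorems.ThreePointIsoSexticEdgeNC (real_update_eq)
open scoped Classical

variable {V : Type*} [Fintype V]

/-- Raising one weight to `1` can only lower the probability that the port is isolated from the terminals
(`c∤T` is a decreasing event). [folklore] -/
theorem real_cIso_update_one_le (w : Sym2 V → unitInterval) (f : Sym2 V) (s a b c : V) :
    (prodBernoulli (Function.update w f 1)).real ((openConn c s)ᶜ ∩ (openConn c a)ᶜ ∩ (openConn c b)ᶜ : Set (BondConfig V)) ≤
      (prodBernoulli (Function.update w f 0)).real ((openConn c s)ᶜ ∩ (openConn c a)ᶜ ∩ (openConn c b)ᶜ : Set (BondConfig V)) := by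
  have h := real_update_eq w f 1 ((openConn c s)ᶜ ∩ (openConn c a)ᶜ ∩ (openConn c b)ᶜ : Set (BondConfig V))
  have h1 : ((1 : unitInterval) : ℝ) = 1 := rfl
  rw [h1, sub_self, zero_mul, zero_add, one_mul] at h
  rw [h]
  refine measureReal_mono ?_ (by finiteness)
  intro ω hω
  simp only [mem_setOf_eq, mem_inter_iff, mem_compl_iff, openConn] at hω ⊢
  have mono : ∀ x y : V, (openGraph ω).Reachable x y → (openGraph (insert f ω)).Reachable x y :=
    fun x y hxy => hxy.mono (openGraph_mono (subset_insert f ω))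
  exact ⟨⟨fun h' => hω.1.1 (mono c s h'), fun h' => hω.1.2 (mono c a h')⟩, fun h' => hω.2 (mono c b h')⟩

/-- **F-monotone segment lemma (one pair).**  Let `f` be any pair.  If the super-terminal quartic law `V4` holds for the two endpoint
weights `w[f ↦ 0]` and `w[f ↦ 1]`, and the pattern probability `μ(F)`, `F = (s↔a) ∩ (s↔b)ᶜ`, does not decrease from `w[f ↦ 0]` to `w[f ↦ 1]`
(`∂μ(F)/∂w_f ≥ 0`), then `V4` holds for `w`.  Proof: every coordinate is affine in `w f` (`prodBernoulli_real_oneBond`), `μ(c∤T)` decreases,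
and the two-state mixture lemma `SuperTerminalQuarticChord.quartic_of_twoStates` (convexity of the V4 region in normal form). [this work] -/
theorem superTerminalQuartic_of_pair (w : Sym2 V → unitInterval) (s a b c : V) (f : Sym2 V)
    (hV0 : (prodBernoulli (Function.update w f 0)).real
        (openConn s a ∩ (openConn s b)ᶜ ∩ ((openConn c s)ᶜ ∩ (openConn c a)ᶜ ∩ (openConn c b)ᶜ) : Set (BondConfig V)) ^ 4 ≤
      (prodBernoulli (Function.update w f 0)).real (openConn s a ∩ (openConn s b)ᶜ ∩ ((openConn c s)ᶜ ∩ (openConn c a)ᶜ) : Set (BondConfig V)) ^ 2 *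
      (prodBernoulli (Function.update w f 0)).real (openConn s a ∩ (openConn s b)ᶜ ∩ (openConn c b)ᶜ : Set (BondConfig V)) ^ 2 *
      (prodBernoulli (Function.update w f 0)).real ((openConn c s)ᶜ ∩ (openConn c a)ᶜ ∩ (openConn c b)ᶜ : Set (BondConfig V)))
    (hV1 : (prodBernoulli (Function.update w f 1)).real
        (openConn s a ∩ (openConn s b)ᶜ ∩ ((openConn c s)ᶜ ∩ (openConn c a)ᶜ ∩ (openConn c b)ᶜ) : Set (BondConfig V)) ^ 4 ≤
      (prodBernoulli (Function.update w f 1)).real (openConn s a ∩ (openConn s b)ᶜ ∩ ((openConn c s)ᶜ ∩ (openConn c a)ᶜ) : Set (BondConfig V)) ^ 2 *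
      (prodBernoulli (Function.update w f 1)).real (openConn s a ∩ (openConn s b)ᶜ ∩ (openConn c b)ᶜ : Set (BondConfig V)) ^ 2 *
      (prodBernoulli (Function.update w f 1)).real ((openConn c s)ᶜ ∩ (openConn c a)ᶜ ∩ (openConn c b)ᶜ : Set (BondConfig V)))
    (hF : (prodBernoulli (Function.update w f 0)).real (openConn s a ∩ (openConn s b)ᶜ : Set (BondConfig V)) ≤
      (prodBernoulli (Function.update w f 1)).real (openConn s a ∩ (openConn s b)ᶜ : Set (BondConfig V))) :
    (prodBernoulli w).real (openConn s a ∩ (openConn s b)ᶜ ∩ ((openConn c s)ᶜ ∩ (openConn c a)ᶜ ∩ (openConn c b)ᶜ) : Set (BondConfig V)) ^ 4 ≤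
      (prodBernoulli w).real (openConn s a ∩ (openConn s b)ᶜ ∩ ((openConn c s)ᶜ ∩ (openConn c a)ᶜ) : Set (BondConfig V)) ^ 2 *
      (prodBernoulli w).real (openConn s a ∩ (openConn s b)ᶜ ∩ (openConn c b)ᶜ : Set (BondConfig V)) ^ 2 *
      (prodBernoulli w).real ((openConn c s)ᶜ ∩ (openConn c a)ᶜ ∩ (openConn c b)ᶜ : Set (BondConfig V)) := by
  have piv : ∀ E : Set (BondConfig V), (prodBernoulli w).real E =
      (1 - (w f : ℝ)) * (prodBernoulli (Function.update w f 0)).real E + (w f : ℝ) * (prodBernoulli (Function.update w f 1)).real E :=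
    fun E => prodBernoulli_real_oneBond (GhostField.determinedBy_univ_of_fintype E) w (Finset.mem_univ f)
  rw [piv, piv, piv, piv]
  set μ₀ := prodBernoulli (Function.update w f 0) with hμ₀
  set μ₁ := prodBernoulli (Function.update w f 1) with hμ₁
  have hs0' := SuperTerminalQuarticFace.real_F_add (Function.update w f 0) s a b c
  have hs1' := SuperTerminalQuarticFace.real_F_add (Function.update w f 1) s a b c
  rw [← hμ₀] at hs0'
  rw [← hμ₁] at hs1'
  have hC := real_cIso_update_one_le w f s a b c
  rw [← hμ₀, ← hμ₁] at hC
  refine SuperTerminalQuarticChord.quartic_of_twoStates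
    (F₀ := μ₀.real (openConn s a ∩ (openConn s b)ᶜ : Set (BondConfig V)))
    (F₁ := μ₁.real (openConn s a ∩ (openConn s b)ᶜ : Set (BondConfig V)))
    measureReal_nonneg (measureReal_mono (fun ω hω => ⟨hω.1, hω.2.1⟩) (by finiteness))
    (measureReal_mono (fun ω hω => ⟨hω.1, hω.2.2⟩) (by finiteness)) (by linarith [hs0']) measureReal_nonneg
    measureReal_nonneg (measureReal_mono (fun ω hω => ⟨hω.1, hω.2.1⟩) (by finiteness))
    (measureReal_mono (fun ω hω => ⟨hω.1, hω.2.2⟩) (by finiteness)) (by linarith [hs1']) measureReal_nonneg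
    hV0 hV1 hF hC (w f).2.1 (w f).2.2

end Summit.CriticalPhenomena.PercolationContinuityZ3.Theorems.SuperTerminalQuarticSegment
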